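import Literature.NumberTheory.Sieve.LargestPrimeFactorCubicLBounds
import Literature.NumberTheory.Sieve.LargestPrimeFactorCubicSquareDivCount
import Literature.NumberTheory.Sieve.LargestPrimeFactorCubicLemma11
import HarnessLib

/-!
# Heath-Brown 2001 (PLMS), Lemma 7, the tail (7.8)–(7.14):
# `∑_{q₁,q₂} ∑_{(a,b): q₁q₂ ∣ a³−2b³} ∑_{d ∣ a³−2b³, d ≥ D} |l(d)|`

Topic `Literature/NumberTheory/Sieve`; a PROVED counting layer (one definition with body, no named facts)
under the named fact `Irving2015_largestPrimeFactor_cubic` (`LargestPrimeFactorCubic.lean`), the tail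
estimate in the proof of Heath-Brown's **Lemma 7**.  Source: D. R. Heath-Brown, *The largest prime factor
of `X³ + 2`*, Proc. London Math. Soc. (3) 82 (2001) 554–596, §7 pp. 27–28: (7.8) "terms with `d ≥ D`
contribute `∑_{q₁,q₂} ∑_{a,b: q₁q₂∣a³−2b³} ∑_{e,f: ef²∣a³−2b³, ef² ≥ D} |l(ef²)|`"; (7.9) `e ≥ D^{1/2}`:
`≪ M²N^{2ε}D^{−1/2}`; (7.10)–(7.12) `e < D^{1/2}`, `f > D^{1/4}`, `(f, q₁q₂) = 1`: `f ≪ N^{5/7}` and by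
(7.11) `≪ N^{3ε}(MN^{5/7} + M²D^{−1/4})`; (7.13)–(7.14) `q₁ ∣ f` or `q₂ ∣ f`: `≪ N^{2ε}(MN^{5/7+δ} +
M²N^{−5/7})`, `≪ N^{2ε}(MN^{6/7+δ} + M²N^{−6/7})`.

We prove a generic version for a square box `(A,A+M]×(B,B+M]` with `A + M, B + M ≤ L`, prime windows
`P₁, P₂` above `Q₁, Q₂`, and a threshold `D ≥ 1`:

* `sum_divisors_ge_abs_lFun_le` (the split `e ≥ √D` / `f² > √D` for one `n`, (7.9)–(7.10));
* `card_filter_radTwo_le` (`d ↦ f`), `sum_sum_filter_eq` (exchanging `∑_{q₁,q₂}` with `∑_{(a,b)}`),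
  `card_pairs_dvd_le` (`#{(q₁,q₂): q₁q₂ ∣ n} ≤ τ(n)²`);
* **`tail_sum_le`** — `T₂ ≤ C L^ε (M²/D^{1/4} + M√(3L³/(Q₁Q₂)) + M + M²/Q₁ + M #P₁ + M²/Q₂ + M #P₂)`.

## References

* D. R. Heath-Brown, *The largest prime factor of `X³ + 2`*, Proc. London Math. Soc. (3) 82 (2001)
  554–596, §7 pp. 27–28 ((7.8)–(7.14)). [`HeathBrown2001LargestPrimeFactorCubic`]

## Mathlib / tree search

Tree: `lFun`, `radOne`, `radTwo`, `radOne_dvd`, `radOne_mul_radTwo_sq`, `abs_lFun_mul_radOne_le`,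
`abs_lFun_le_card_divisors`, `two_pow_omega_le_card_divisors`, `radOne_pos` (`…LBounds`),
`card_box_coprime_dvd_le` (`…SquareDivCount`), `exists_card_rootsCube_le_rpow`,
`cube_sub_two_mul_cube_ne_zero` (`…RootPairs`), `exists_card_divisors_le_mul_rpow` (`DivisorBound`),
`sum_Ioc_inv_sq_le` (`…KProduct`), `half_le_nat_floor` (`…Lemma11`).
-/

noncomputable section

open Finset Real

namespace Literature.NumberTheory.Sieve.HeathBrown2001

/-! ### One integer `n`: the split (7.9)/(7.10) -/

/-- `τ(d) ≤ τ(n)` for `d ∣ n`, `n ≠ 0`. [folklore] -/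
theorem card_divisors_le_of_dvd {d n : ℕ} (h : d ∣ n) (hn : n ≠ 0) : #d.divisors ≤ #n.divisors :=
  card_le_card (Nat.divisors_subset_of_dvd hn h)

/-- **(7.9)–(7.10) for one `n`**: `∑_{d∣n, d≥D} |l(d)| ≤ τ(n)³/√D + τ(n)·#{d ∣ n : l(d) ≠ 0, √D < f_d²}`.
[cite: HeathBrown2001LargestPrimeFactorCubic, §7 p. 27 ((7.9)–(7.10))] -/
theorem sum_divisors_ge_abs_lFun_le {n D : ℕ} (hn : n ≠ 0) (hD : 1 ≤ D) :
    ∑ d ∈ n.divisors.filter (fun d => D ≤ d), |lFun d| ≤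
      (#n.divisors : ℝ) ^ 3 / Real.sqrt D +
        (#n.divisors : ℝ) * #(n.divisors.filter fun d => lFun d ≠ 0 ∧ Real.sqrt D < ((radTwo d ^ 2 : ℕ) : ℝ)) := by
  classical
  set τn : ℝ := ((#n.divisors : ℕ) : ℝ) with hτn
  set S := n.divisors.filter (fun d => D ≤ d) with hS
  have hD0 : (0 : ℝ) < D := by exact_mod_cast hD
  have hsD : 0 < Real.sqrt D := Real.sqrt_pos.mpr hD0
  rw [← sum_filter_add_sum_filter_not S (fun d => Real.sqrt D ≤ (radOne d : ℝ))]
  -- Part 1: `e ≥ √D`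
  have h1 : ∑ d ∈ S.filter (fun d => Real.sqrt D ≤ (radOne d : ℝ)), |lFun d| ≤ τn ^ 3 / Real.sqrt D := by
    have hterm : ∀ d ∈ S.filter (fun d => Real.sqrt D ≤ (radOne d : ℝ)), |lFun d| ≤ τn ^ 2 / Real.sqrt D := by
      intro d hd
      rw [mem_filter, hS, mem_filter, Nat.mem_divisors] at hd
      obtain ⟨⟨⟨hdn, -⟩, -⟩, hrad⟩ := hd
      have hd0 : d ≠ 0 := ne_zero_of_dvd_ne_zero hn hdn
      have hrad0 : (0 : ℝ) < radOne d := by exact_mod_cast radOne_pos d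
      have hl := abs_lFun_mul_radOne_le d
      have h4 : (4 : ℝ) ^ d.primeFactors.card ≤ τn ^ 2 := by
        have h2 : (2 : ℝ) ^ d.primeFactors.card ≤ #d.divisors := by exact_mod_cast two_pow_omega_le_card_divisors hd0
        have h3 : (#d.divisors : ℝ) ≤ τn := by rw [hτn]; exact_mod_cast card_divisors_le_of_dvd hdn hn
        calc (4 : ℝ) ^ d.primeFactors.card = ((2 : ℝ) ^ d.primeFactors.card) ^ 2 := by
              rw [← pow_mul, show (4 : ℝ) = 2 ^ 2 by norm_num, ← pow_mul, mul_comm]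
          _ ≤ τn ^ 2 := pow_le_pow_left₀ (by positivity) (h2.trans h3) 2
      rw [le_div_iff₀ hsD]
      calc |lFun d| * Real.sqrt D ≤ |lFun d| * radOne d := mul_le_mul_of_nonneg_left hrad (abs_nonneg _)
        _ = (radOne d : ℝ) * |lFun d| := mul_comm _ _
        _ ≤ τn ^ 2 := hl.trans h4
    calc ∑ d ∈ S.filter (fun d => Real.sqrt D ≤ (radOne d : ℝ)), |lFun d|
        ≤ ∑ _d ∈ S.filter (fun d => Real.sqrt D ≤ (radOne d : ℝ)), τn ^ 2 / Real.sqrt D := sum_le_sum hterm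
      _ = #(S.filter (fun d => Real.sqrt D ≤ (radOne d : ℝ))) * (τn ^ 2 / Real.sqrt D) := by rw [sum_const, nsmul_eq_mul]
      _ ≤ τn * (τn ^ 2 / Real.sqrt D) := by
          gcongr
          rw [hτn]; exact_mod_cast card_le_card ((filter_subset _ _).trans (filter_subset _ _))
      _ = τn ^ 3 / Real.sqrt D := by ring
  -- Part 2: `e < √D`, hence `f² > √D` when `l(d) ≠ 0`
  have h2 : ∑ d ∈ S.filter (fun d => ¬ Real.sqrt D ≤ (radOne d : ℝ)), |lFun d| ≤
      τn * #(n.divisors.filter fun d => lFun d ≠ 0 ∧ Real.sqrt D < ((radTwo d ^ 2 : ℕ) : ℝ)) := by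
    -- drop the `d` with `l(d) = 0`
    rw [← sum_filter_ne_zero]
    have hsub : (S.filter (fun d => ¬ Real.sqrt D ≤ (radOne d : ℝ))).filter (fun d => |lFun d| ≠ 0) ⊆
        n.divisors.filter fun d => lFun d ≠ 0 ∧ Real.sqrt D < ((radTwo d ^ 2 : ℕ) : ℝ) := by
      intro d hd
      rw [mem_filter, mem_filter, hS, mem_filter] at hd
      obtain ⟨⟨⟨hdn, hDd⟩, hrad⟩, hl⟩ := hd
      rw [abs_ne_zero] at hl
      rw [mem_filter]
      refine ⟨hdn, hl, ?_⟩
      have hd0 : d ≠ 0 := ne_zero_of_dvd_ne_zero hn (Nat.mem_divisors.mp hdn).1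
      have hdec := radOne_mul_radTwo_sq hd0 hl
      have hrad0 : (0 : ℝ) < radOne d := by exact_mod_cast radOne_pos d
      rw [not_le] at hrad
      -- `f² = d / e ≥ D / e > D/√D = √D`
      have hdec' : (radOne d : ℝ) * ((radTwo d ^ 2 : ℕ) : ℝ) = d := by exact_mod_cast hdec
      have hDd' : (D : ℝ) ≤ d := by exact_mod_cast hDd
      by_contra hcon
      rw [not_lt] at hcon
      have : (d : ℝ) ≤ radOne d * Real.sqrt D := by rw [← hdec']; exact mul_le_mul_of_nonneg_left hcon hrad0.le
      have h' : (radOne d : ℝ) * Real.sqrt D < Real.sqrt D * Real.sqrt D := mul_lt_mul_of_pos_right hrad hsD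
      rw [Real.mul_self_sqrt hD0.le] at h'
      linarith
    calc ∑ d ∈ (S.filter (fun d => ¬ Real.sqrt D ≤ (radOne d : ℝ))).filter (fun d => |lFun d| ≠ 0), |lFun d|
        ≤ ∑ d ∈ n.divisors.filter (fun d => lFun d ≠ 0 ∧ Real.sqrt D < ((radTwo d ^ 2 : ℕ) : ℝ)), |lFun d| :=
          sum_le_sum_of_subset_of_nonneg hsub fun _ _ _ => abs_nonneg _
      _ ≤ ∑ _d ∈ n.divisors.filter (fun d => lFun d ≠ 0 ∧ Real.sqrt D < ((radTwo d ^ 2 : ℕ) : ℝ)), τn := by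
          refine sum_le_sum fun d hd => ?_
          rw [mem_filter, Nat.mem_divisors] at hd
          have hd0 : d ≠ 0 := ne_zero_of_dvd_ne_zero hn hd.1.1
          calc |lFun d| ≤ #d.divisors := abs_lFun_le_card_divisors hd0
            _ ≤ τn := by rw [hτn]; exact_mod_cast card_divisors_le_of_dvd hd.1.1 hn
      _ = τn * #(n.divisors.filter fun d => lFun d ≠ 0 ∧ Real.sqrt D < ((radTwo d ^ 2 : ℕ) : ℝ)) := by
          rw [sum_const, nsmul_eq_mul, mul_comm]
  linarith

/-- **`d ↦ f`**: `#{d ∣ n : l(d) ≠ 0, √D < f_d²} ≤ τ(n) · #{f ∣ n : √D < f², f² ∣ n}`. [cite: HeathBrown2001LargestPrimeFactorCubic, §7 p. 27 (7.10)] -/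
theorem card_filter_radTwo_le {n D : ℕ} (hn : n ≠ 0) :
    #(n.divisors.filter fun d => lFun d ≠ 0 ∧ Real.sqrt D < ((radTwo d ^ 2 : ℕ) : ℝ)) ≤
      #n.divisors * #(n.divisors.filter fun f => Real.sqrt D < ((f ^ 2 : ℕ) : ℝ) ∧ f ^ 2 ∣ n) := by
  classical
  set S := n.divisors.filter fun d => lFun d ≠ 0 ∧ Real.sqrt D < ((radTwo d ^ 2 : ℕ) : ℝ) with hS
  set T := n.divisors.filter fun f => Real.sqrt D < ((f ^ 2 : ℕ) : ℝ) ∧ f ^ 2 ∣ n with hT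
  have hmaps : ∀ d ∈ S, radTwo d ∈ T := by
    intro d hd
    rw [hS, mem_filter, Nat.mem_divisors] at hd
    obtain ⟨⟨hdn, -⟩, -, hlt⟩ := hd
    have hf2 : radTwo d ^ 2 ∣ n := (radOne_dvd d).2.trans hdn
    rw [hT, mem_filter, Nat.mem_divisors]
    exact ⟨⟨(Dvd.intro_left _ (pow_two (radTwo d)).symm |>.trans hf2), hn⟩, hlt, hf2⟩
  rw [card_eq_sum_card_fiberwise hmaps]
  calc ∑ f ∈ T, #(S.filter fun d => radTwo d = f) ≤ ∑ _f ∈ T, #n.divisors := by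
        refine sum_le_sum fun f _ => card_le_card ?_
        intro d hd
        rw [mem_filter, hS, mem_filter] at hd
        exact hd.1.1
    _ = #n.divisors * #T := by rw [sum_const, smul_eq_mul, mul_comm]

/-! ### The box, `n = |a³ − 2b³|`, and exchanging the order of summation -/

/-- `n(a,b) = |a³ − 2b³|`. [cite: HeathBrown2001LargestPrimeFactorCubic, §7 p. 26] -/
def qn (ab : ℕ × ℕ) : ℕ := ((ab.1 : ℤ) ^ 3 - 2 * (ab.2 : ℤ) ^ 3).natAbs

/-- `n(a,b) ≠ 0` for `a ≥ 1`. [folklore] -/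
theorem qn_ne_zero {ab : ℕ × ℕ} (ha : 1 ≤ ab.1) : qn ab ≠ 0 := by
  rw [qn, Int.natAbs_ne_zero]
  refine cube_sub_two_mul_cube_ne_zero ?_
  rintro ⟨-, h⟩
  have : (ab.1 : ℤ) = 0 := h
  omega

/-- `n(a,b) ≤ 3L³` for `a, b ≤ L`. [folklore] -/
theorem qn_le {ab : ℕ × ℕ} {L : ℕ} (ha : ab.1 ≤ L) (hb : ab.2 ≤ L) : (qn ab : ℝ) ≤ 3 * (L : ℝ) ^ 3 := by
  have h1 : ((qn ab : ℕ) : ℝ) = |((ab.1 : ℝ)) ^ 3 - 2 * (ab.2 : ℝ) ^ 3| := by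
    have : ((qn ab : ℕ) : ℤ) = |(ab.1 : ℤ) ^ 3 - 2 * (ab.2 : ℤ) ^ 3| := by rw [qn, Int.natCast_natAbs]
    have := congrArg (Int.cast : ℤ → ℝ) this
    push_cast at this
    exact this
  rw [h1]
  have ha' : (ab.1 : ℝ) ≤ L := by exact_mod_cast ha
  have hb' : (ab.2 : ℝ) ≤ L := by exact_mod_cast hb
  have ha0 : (0 : ℝ) ≤ ab.1 := Nat.cast_nonneg _
  have hb0 : (0 : ℝ) ≤ ab.2 := Nat.cast_nonneg _
  have hL0 : (0 : ℝ) ≤ L := Nat.cast_nonneg _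
  have h3a : (ab.1 : ℝ) ^ 3 ≤ (L : ℝ) ^ 3 := pow_le_pow_left₀ ha0 ha' 3
  have h3b : (ab.2 : ℝ) ^ 3 ≤ (L : ℝ) ^ 3 := pow_le_pow_left₀ hb0 hb' 3
  rw [abs_le]; constructor <;> nlinarith [pow_nonneg ha0 3, pow_nonneg hb0 3, pow_nonneg hL0 3]

/-- The dyadic divisor-pair count: `#{(q₁,q₂) ∈ P₁ × P₂ : q₁q₂ ∣ n} ≤ τ(n)²` (`n ≠ 0`). [folklore] -/
theorem card_pairs_dvd_le (P₁ P₂ : Finset ℕ) {n : ℕ} (hn : n ≠ 0) :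
    #((P₁ ×ˢ P₂).filter fun q : ℕ × ℕ => q.1 * q.2 ∣ n) ≤ #n.divisors ^ 2 := by
  calc #((P₁ ×ˢ P₂).filter fun q : ℕ × ℕ => q.1 * q.2 ∣ n) ≤ #(n.divisors ×ˢ n.divisors) := by
        refine card_le_card fun q hq => ?_
        rw [mem_filter] at hq
        rw [mem_product, Nat.mem_divisors, Nat.mem_divisors]
        exact ⟨⟨(dvd_mul_right _ _).trans hq.2, hn⟩, (dvd_mul_left _ _).trans hq.2, hn⟩
    _ = #n.divisors ^ 2 := by rw [card_product, sq]

/-- `#{q ∈ P : q ∣ n} ≤ τ(n)` (`n ≠ 0`). [folklore] -/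
theorem card_filter_dvd_le (P : Finset ℕ) {n : ℕ} (hn : n ≠ 0) :
    #(P.filter fun q : ℕ => q ∣ n) ≤ #n.divisors :=
  card_le_card fun _ hq => Nat.mem_divisors.mpr ⟨(mem_filter.mp hq).2, hn⟩

/-- **Exchanging `∑_{q₁,q₂}` with `∑_{(a,b)}`**: for `G ≥ 0`-free (an identity),
`∑_{q₁∈P₁}∑_{q₂∈P₂} ∑_{ab ∈ box, c(ab), q₁q₂ ∣ n(ab)} G(ab) = ∑_{ab ∈ box, c(ab)} G(ab) · #{(q₁,q₂) : q₁q₂ ∣ n(ab)}`.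
[folklore] -/
theorem sum_sum_filter_eq (P₁ P₂ : Finset ℕ) (box : Finset (ℕ × ℕ)) (c : ℕ × ℕ → Prop) [DecidablePred c]
    (G : ℕ × ℕ → ℝ) :
    ∑ q₁ ∈ P₁, ∑ q₂ ∈ P₂, ∑ ab ∈ box.filter (fun ab => c ab ∧ q₁ * q₂ ∣ qn ab), G ab =
      ∑ ab ∈ box.filter c, G ab * #((P₁ ×ˢ P₂).filter fun q : ℕ × ℕ => q.1 * q.2 ∣ qn ab) := by
  classical
  have h1 : ∀ q₁ ∈ P₁, ∀ q₂ ∈ P₂, ∑ ab ∈ box.filter (fun ab => c ab ∧ q₁ * q₂ ∣ qn ab), G ab =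
      ∑ ab ∈ box.filter c, if q₁ * q₂ ∣ qn ab then G ab else 0 := by
    intro q₁ _ q₂ _
    rw [sum_filter, sum_filter]
    refine sum_congr rfl fun ab _ => ?_
    by_cases hc : c ab <;> simp [hc]
  rw [sum_congr rfl fun q₁ hq₁ => sum_congr rfl fun q₂ hq₂ => h1 q₁ hq₁ q₂ hq₂]
  rw [← sum_product' (f := fun q₁ q₂ => ∑ ab ∈ box.filter c, if q₁ * q₂ ∣ qn ab then G ab else 0), sum_comm]
  refine sum_congr rfl fun ab _ => ?_
  rw [card_filter, Nat.cast_sum, mul_sum]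
  refine sum_congr rfl fun q _ => ?_
  split_ifs <;> simp

/-- Single exchange: `∑_{q∈P} ∑_{ab ∈ box, c(ab), q ∣ n(ab)} G(ab) = ∑_{ab ∈ box, c(ab)} G(ab) · #{q ∈ P : q ∣ n(ab)}`. [folklore] -/
theorem sum_filter_eq_single (P : Finset ℕ) (box : Finset (ℕ × ℕ)) (c : ℕ × ℕ → Prop) [DecidablePred c]
    (m : ℕ → ℕ) (G : ℕ × ℕ → ℝ) :
    ∑ q ∈ P, ∑ ab ∈ box.filter (fun ab => c ab ∧ m q ∣ qn ab), G ab =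
      ∑ ab ∈ box.filter c, G ab * #(P.filter fun q : ℕ => m q ∣ qn ab) := by
  classical
  have h1 : ∀ q ∈ P, ∑ ab ∈ box.filter (fun ab => c ab ∧ m q ∣ qn ab), G ab =
      ∑ ab ∈ box.filter c, if m q ∣ qn ab then G ab else 0 := by
    intro q _
    rw [sum_filter, sum_filter]
    refine sum_congr rfl fun ab _ => ?_
    by_cases hc : c ab <;> simp [hc]
  rw [sum_congr rfl h1, sum_comm]
  refine sum_congr rfl fun ab _ => ?_
  rw [card_filter, Nat.cast_sum, mul_sum]
  refine sum_congr rfl fun q _ => ?_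
  split_ifs <;> simp

/-! ### The `f`-set of one `n` and its three ranges -/

/-- `T(n) ⊆ T_cop ∪ T_{q₁} ∪ T_{q₂}`: a divisor `f` not coprime to `q₁q₂` (primes) is divisible by `q₁` or `q₂`.
[cite: HeathBrown2001LargestPrimeFactorCubic, §7 p. 28 ("terms for which q₁, say, divides f")] -/
theorem card_T_le_three (n : ℕ) (D : ℕ) {q₁ q₂ : ℕ} (hq₁ : q₁.Prime) (hq₂ : q₂.Prime) :
    #(n.divisors.filter fun f => Real.sqrt D < ((f ^ 2 : ℕ) : ℝ) ∧ f ^ 2 ∣ n) ≤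
      #(n.divisors.filter fun f => (Real.sqrt D < ((f ^ 2 : ℕ) : ℝ) ∧ f ^ 2 ∣ n) ∧ Nat.Coprime f (q₁ * q₂)) +
      #(n.divisors.filter fun f => (Real.sqrt D < ((f ^ 2 : ℕ) : ℝ) ∧ f ^ 2 ∣ n) ∧ q₁ ∣ f) +
      #(n.divisors.filter fun f => (Real.sqrt D < ((f ^ 2 : ℕ) : ℝ) ∧ f ^ 2 ∣ n) ∧ q₂ ∣ f) := by
  classical
  refine le_trans (card_le_card ?_) ((card_union_le _ _).trans (Nat.add_le_add_right (card_union_le _ _) _))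
  intro f hf
  rw [mem_filter] at hf
  rw [mem_union, mem_union, mem_filter, mem_filter, mem_filter]
  by_cases hc : Nat.Coprime f (q₁ * q₂)
  · exact Or.inl (Or.inl ⟨hf.1, hf.2, hc⟩)
  · rw [Nat.coprime_mul_iff_right, not_and_or] at hc
    rcases hc with h | h
    · refine Or.inl (Or.inr ⟨hf.1, hf.2, ?_⟩)
      rw [Nat.coprime_comm, hq₁.coprime_iff_not_dvd, not_not] at h; exact h
    · refine Or.inr ⟨hf.1, hf.2, ?_⟩
      rw [Nat.coprime_comm, hq₂.coprime_iff_not_dvd, not_not] at h; exact h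

/-- Range (α): for `f` coprime to `q₁q₂` with `q₁q₂ ∣ n`, `f² ∣ n`: `f ≤ F = ⌊√(3L³/(Q₁Q₂))⌋` when `n ≤ 3L³`,
`Q₁ < q₁`, `Q₂ < q₂`; so `T_cop(n) ⊆ {f ∈ [1, F] : √D < f², f² ∣ n}`. [cite: HeathBrown2001LargestPrimeFactorCubic, §7 p. 27 ("f ≪ N^{5/7}")] -/
theorem card_Tcop_le {n D q₁ q₂ Q₁ Q₂ L : ℕ} (hn : n ≠ 0) (hnL : (n : ℝ) ≤ 3 * (L : ℝ) ^ 3)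
    (hq₁ : Q₁ < q₁) (hq₂ : Q₂ < q₂) (hQ₁ : 1 ≤ Q₁) (hQ₂ : 1 ≤ Q₂) (hqn : q₁ * q₂ ∣ n) :
    #(n.divisors.filter fun f => (Real.sqrt D < ((f ^ 2 : ℕ) : ℝ) ∧ f ^ 2 ∣ n) ∧ Nat.Coprime f (q₁ * q₂)) ≤
      #((Icc 1 ⌊Real.sqrt (3 * (L : ℝ) ^ 3 / ((Q₁ : ℝ) * Q₂))⌋₊).filter fun f =>
        Real.sqrt D < ((f ^ 2 : ℕ) : ℝ) ∧ f ^ 2 ∣ n) := by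
  refine card_le_card fun f hf => ?_
  rw [mem_filter, Nat.mem_divisors] at hf
  obtain ⟨⟨hfn, -⟩, ⟨hD, hf2⟩, hcop⟩ := hf
  rw [mem_filter, mem_Icc]
  refine ⟨⟨Nat.pos_of_dvd_of_pos hfn (Nat.pos_of_ne_zero hn), ?_⟩, hD, hf2⟩
  -- `q₁ q₂ f² ∣ n`, so `f² ≤ n/(q₁q₂) ≤ 3L³/(Q₁Q₂)`
  have hdvd : f ^ 2 * (q₁ * q₂) ∣ n := Nat.Coprime.mul_dvd_of_dvd_of_dvd (Nat.Coprime.pow_left 2 hcop) hf2 hqn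
  have hle : f ^ 2 * (q₁ * q₂) ≤ n := Nat.le_of_dvd (Nat.pos_of_ne_zero hn) hdvd
  have hQ : (0 : ℝ) < (Q₁ : ℝ) * Q₂ := by positivity
  have hqq : (Q₁ : ℝ) * Q₂ ≤ (q₁ : ℝ) * q₂ := by
    have : Q₁ * Q₂ ≤ q₁ * q₂ := Nat.mul_le_mul hq₁.le hq₂.le
    exact_mod_cast this
  have hf2le : ((f : ℝ)) ^ 2 ≤ 3 * (L : ℝ) ^ 3 / ((Q₁ : ℝ) * Q₂) := by
    rw [le_div_iff₀ hQ]
    have h1 : ((f : ℝ)) ^ 2 * ((q₁ : ℝ) * q₂) ≤ (n : ℝ) := by exact_mod_cast hle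
    calc ((f : ℝ)) ^ 2 * ((Q₁ : ℝ) * Q₂) ≤ ((f : ℝ)) ^ 2 * ((q₁ : ℝ) * q₂) := by gcongr
      _ ≤ (n : ℝ) := h1
      _ ≤ 3 * (L : ℝ) ^ 3 := hnL
  refine Nat.le_floor ?_
  rw [Real.le_sqrt (Nat.cast_nonneg _) (by positivity)]
  exact hf2le

/-- Range (β): if `T_{q₁}(n) ≠ ∅` then `q₁² ∣ n`, and `#T_{q₁}(n) ≤ τ(n)`. [cite: HeathBrown2001LargestPrimeFactorCubic, §7 p. 28 (7.13)] -/
theorem card_Tq_le {n D q : ℕ} :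
    (#(n.divisors.filter fun f => (Real.sqrt D < ((f ^ 2 : ℕ) : ℝ) ∧ f ^ 2 ∣ n) ∧ q ∣ f) : ℝ) ≤
      if q ^ 2 ∣ n then (#n.divisors : ℝ) else 0 := by
  split_ifs with h
  · exact_mod_cast card_le_card (filter_subset _ _)
  · have h0 : #(n.divisors.filter fun f => (Real.sqrt D < ((f ^ 2 : ℕ) : ℝ) ∧ f ^ 2 ∣ n) ∧ q ∣ f) = 0 := by
      rw [card_eq_zero, filter_eq_empty_iff]
      rintro f - ⟨⟨-, hf2⟩, hqf⟩
      exact h ((pow_dvd_pow_of_dvd hqf 2).trans hf2)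
    rw [h0]; simp

/-! ### The main sum -/

/-- `cop(a,b)`: coprimality predicate on the box. [folklore] -/
def Cop (ab : ℕ × ℕ) : Prop := Nat.Coprime ab.1 ab.2

/-- Auxiliary: `Cop` is decidable. [folklore] -/
instance : DecidablePred Cop := fun ab => inferInstanceAs (Decidable (Nat.Coprime ab.1 ab.2))

/-- `(7.11)` in the `qn`-language: `#{(a,b) ∈ box : (a,b)=1, m ∣ n(a,b)} ≤ M·#rootsCube(m)·(M/m + 1)` (`m ≥ 1`). [cite: HeathBrown2001LargestPrimeFactorCubic, (7.11)] -/
theorem card_box_cop_dvd_le {m : ℕ} (hm : 0 < m) (A B M : ℕ) :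
    (#((Ioc A (A + M) ×ˢ Ioc B (B + M)).filter fun ab : ℕ × ℕ => Cop ab ∧ m ∣ qn ab) : ℝ) ≤
      M * (#(rootsCube m) * ((M : ℝ) / m + 1)) := by
  have h := card_box_coprime_dvd_le hm A M (Ioc B (B + M))
  rw [Nat.card_Ioc, Nat.add_sub_cancel_left] at h
  refine le_trans (le_of_eq ?_) h
  congr 2
  refine filter_congr fun ab _ => ?_
  simp only [Cop, qn]
  exact Iff.and Iff.rfl Int.ofNat_dvd_left.symm


/-- Uniform bounds on the box: `n(a,b) ≠ 0`, `τ(n) ≤ τmax`, for `ab ∈ box`, `A + M, B + M ≤ L`. [folklore] -/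
theorem tau_le_of_mem_box {Cd ε : ℝ} (hCd : 0 ≤ Cd) (hε : 0 ≤ ε)
    (hdiv : ∀ n : ℕ, n ≠ 0 → (#n.divisors : ℝ) ≤ Cd * (n : ℝ) ^ ε)
    {A B M L : ℕ} (hAL : A + M ≤ L) (hBL : B + M ≤ L) {ab : ℕ × ℕ} (hab : ab ∈ Ioc A (A + M) ×ˢ Ioc B (B + M)) :
    qn ab ≠ 0 ∧ (qn ab : ℝ) ≤ 3 * (L : ℝ) ^ 3 ∧ (#(qn ab).divisors : ℝ) ≤ Cd * (3 * (L : ℝ) ^ 3) ^ ε := by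
  rw [mem_product, mem_Ioc, mem_Ioc] at hab
  have hn0 : qn ab ≠ 0 := qn_ne_zero (by omega)
  have hnL : (qn ab : ℝ) ≤ 3 * (L : ℝ) ^ 3 := qn_le (by omega) (by omega)
  refine ⟨hn0, hnL, (hdiv _ hn0).trans ?_⟩
  gcongr

set_option maxHeartbeats 1600000 in
/-- **Range (α) summed** ((7.10)–(7.12)):
`∑_{q₁,q₂} ∑_{ab: cop, q₁q₂∣n} τ(n)² #T_cop(n) ≤ τmax⁴ · ∑_{f ≤ F, √D<f²} M ρ₃(f²)(M/f² + 1)`.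
[cite: HeathBrown2001LargestPrimeFactorCubic, §7 pp. 27–28 ((7.10)–(7.12))] -/
theorem alpha_sum_le {Cd ε : ℝ} (hCd : 0 ≤ Cd) (hε : 0 ≤ ε)
    (hdiv : ∀ n : ℕ, n ≠ 0 → (#n.divisors : ℝ) ≤ Cd * (n : ℝ) ^ ε)
    (P₁ P₂ : Finset ℕ) {Q₁ Q₂ : ℕ} (hP₁ : ∀ q ∈ P₁, q.Prime ∧ Q₁ < q) (hP₂ : ∀ q ∈ P₂, q.Prime ∧ Q₂ < q)
    (hQ₁ : 1 ≤ Q₁) (hQ₂ : 1 ≤ Q₂) (D : ℕ) {A B M L : ℕ} (hAL : A + M ≤ L) (hBL : B + M ≤ L) :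
    ∑ q₁ ∈ P₁, ∑ q₂ ∈ P₂, ∑ ab ∈ (Ioc A (A + M) ×ˢ Ioc B (B + M)).filter (fun ab => Cop ab ∧ q₁ * q₂ ∣ qn ab),
        (#(qn ab).divisors : ℝ) ^ 2 *
          #((qn ab).divisors.filter fun f => (Real.sqrt D < ((f ^ 2 : ℕ) : ℝ) ∧ f ^ 2 ∣ qn ab) ∧ Nat.Coprime f (q₁ * q₂)) ≤
      (Cd * (3 * (L : ℝ) ^ 3) ^ ε) ^ 4 *
        ∑ f ∈ (Icc 1 ⌊Real.sqrt (3 * (L : ℝ) ^ 3 / ((Q₁ : ℝ) * Q₂))⌋₊).filter (fun f => Real.sqrt D < ((f ^ 2 : ℕ) : ℝ)),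
          (M : ℝ) * (#(rootsCube (f ^ 2)) * ((M : ℝ) / ((f ^ 2 : ℕ) : ℝ) + 1)) := by
  classical
  set box := Ioc A (A + M) ×ˢ Ioc B (B + M) with hbox
  set τm : ℝ := Cd * (3 * (L : ℝ) ^ 3) ^ ε with hτm
  set Fs := (Icc 1 ⌊Real.sqrt (3 * (L : ℝ) ^ 3 / ((Q₁ : ℝ) * Q₂))⌋₊).filter (fun f => Real.sqrt D < ((f ^ 2 : ℕ) : ℝ)) with hFs
  have hτm0 : 0 ≤ τm := by positivity
  have hbnd : ∀ ab ∈ box, qn ab ≠ 0 ∧ (qn ab : ℝ) ≤ 3 * (L : ℝ) ^ 3 ∧ (#(qn ab).divisors : ℝ) ≤ τm :=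
    fun ab hab => tau_le_of_mem_box hCd hε hdiv hAL hBL hab
  -- Step 1: per term, `τ(n)² #T_cop ≤ τm² ∑_{f ∈ Fs} [f² ∣ n]`
  have hstep1 : ∀ q₁ ∈ P₁, ∀ q₂ ∈ P₂, ∀ ab ∈ box.filter (fun ab => Cop ab ∧ q₁ * q₂ ∣ qn ab),
      (#(qn ab).divisors : ℝ) ^ 2 *
          #((qn ab).divisors.filter fun f => (Real.sqrt D < ((f ^ 2 : ℕ) : ℝ) ∧ f ^ 2 ∣ qn ab) ∧ Nat.Coprime f (q₁ * q₂)) ≤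
        τm ^ 2 * ∑ f ∈ Fs, if f ^ 2 ∣ qn ab then (1 : ℝ) else 0 := by
    intro q₁ hq₁ q₂ hq₂ ab hab
    rw [mem_filter] at hab
    obtain ⟨hn0, hnL, hτ⟩ := hbnd ab hab.1
    have hc := card_Tcop_le (D := D) hn0 hnL (hP₁ q₁ hq₁).2 (hP₂ q₂ hq₂).2 hQ₁ hQ₂ hab.2.2
    have hc' : (#((qn ab).divisors.filter fun f => (Real.sqrt D < ((f ^ 2 : ℕ) : ℝ) ∧ f ^ 2 ∣ qn ab) ∧ Nat.Coprime f (q₁ * q₂)) : ℝ) ≤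
        ∑ f ∈ Fs, if f ^ 2 ∣ qn ab then (1 : ℝ) else 0 := by
      rw [← sum_filter, sum_const, nsmul_eq_mul, mul_one, hFs, filter_filter]
      exact_mod_cast hc
    have hτ2 : (#(qn ab).divisors : ℝ) ^ 2 ≤ τm ^ 2 := pow_le_pow_left₀ (Nat.cast_nonneg _) hτ 2
    exact mul_le_mul hτ2 hc' (Nat.cast_nonneg _) (by positivity)
  -- Step 2: per `(q₁, q₂)`, rewrite `∑_{ab} τm² ∑_f [f²∣n]` as `τm² ∑_f cnt(f,q₁,q₂)`
  set cnt : ℕ → ℕ → ℕ → ℕ := fun f q₁ q₂ =>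
    #(box.filter fun ab => (Cop ab ∧ f ^ 2 ∣ qn ab) ∧ q₁ * q₂ ∣ qn ab) with hcnt
  have hg : ∀ q₁ q₂ : ℕ, ∑ ab ∈ box.filter (fun ab => Cop ab ∧ q₁ * q₂ ∣ qn ab),
      τm ^ 2 * ∑ f ∈ Fs, (if f ^ 2 ∣ qn ab then (1 : ℝ) else 0) = τm ^ 2 * ∑ f ∈ Fs, (cnt f q₁ q₂ : ℝ) := by
    intro q₁ q₂
    rw [← mul_sum, sum_comm]
    congr 1
    refine sum_congr rfl fun f _ => ?_
    rw [hcnt]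
    simp only
    rw [card_filter, Nat.cast_sum, sum_filter]
    refine sum_congr rfl fun ab _ => ?_
    by_cases h1 : Cop ab <;> by_cases h2 : f ^ 2 ∣ qn ab <;> by_cases h3 : q₁ * q₂ ∣ qn ab <;> simp [h1, h2, h3]
  -- Step 3: `∑_{q₁,q₂} cnt(f,q₁,q₂) ≤ τm² #{ab : cop, f² ∣ n}`
  have hf : ∀ f ∈ Fs, ∑ q₁ ∈ P₁, ∑ q₂ ∈ P₂, (cnt f q₁ q₂ : ℝ) ≤ τm ^ 2 * #(box.filter fun ab => Cop ab ∧ f ^ 2 ∣ qn ab) := by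
    intro f _
    have h1 : ∀ q₁ q₂ : ℕ, (cnt f q₁ q₂ : ℝ) =
        ∑ ab ∈ box.filter (fun ab => (Cop ab ∧ f ^ 2 ∣ qn ab) ∧ q₁ * q₂ ∣ qn ab), (1 : ℝ) := by
      intro q₁ q₂; rw [hcnt]; simp
    simp_rw [h1]
    rw [sum_sum_filter_eq P₁ P₂ box (fun ab => Cop ab ∧ f ^ 2 ∣ qn ab) (fun _ => 1)]
    calc ∑ ab ∈ box.filter (fun ab => Cop ab ∧ f ^ 2 ∣ qn ab), (1 : ℝ) * #((P₁ ×ˢ P₂).filter fun q : ℕ × ℕ => q.1 * q.2 ∣ qn ab)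
        ≤ ∑ _ab ∈ box.filter (fun ab => Cop ab ∧ f ^ 2 ∣ qn ab), τm ^ 2 := by
          refine sum_le_sum fun ab hab => ?_
          rw [one_mul]
          rw [mem_filter] at hab
          obtain ⟨hn0, -, hτ⟩ := hbnd ab hab.1
          calc (#((P₁ ×ˢ P₂).filter fun q : ℕ × ℕ => q.1 * q.2 ∣ qn ab) : ℝ) ≤ (#(qn ab).divisors : ℝ) ^ 2 := by
                exact_mod_cast card_pairs_dvd_le P₁ P₂ hn0
            _ ≤ τm ^ 2 := pow_le_pow_left₀ (Nat.cast_nonneg _) hτ 2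
      _ = τm ^ 2 * #(box.filter fun ab => Cop ab ∧ f ^ 2 ∣ qn ab) := by rw [sum_const, nsmul_eq_mul, mul_comm]
  -- Step 4: assemble
  calc ∑ q₁ ∈ P₁, ∑ q₂ ∈ P₂, ∑ ab ∈ box.filter (fun ab => Cop ab ∧ q₁ * q₂ ∣ qn ab),
        (#(qn ab).divisors : ℝ) ^ 2 *
          #((qn ab).divisors.filter fun f => (Real.sqrt D < ((f ^ 2 : ℕ) : ℝ) ∧ f ^ 2 ∣ qn ab) ∧ Nat.Coprime f (q₁ * q₂))
      ≤ ∑ q₁ ∈ P₁, ∑ q₂ ∈ P₂, ∑ ab ∈ box.filter (fun ab => Cop ab ∧ q₁ * q₂ ∣ qn ab),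
          τm ^ 2 * ∑ f ∈ Fs, if f ^ 2 ∣ qn ab then (1 : ℝ) else 0 :=
        sum_le_sum fun q₁ hq₁ => sum_le_sum fun q₂ hq₂ => sum_le_sum fun ab hab => hstep1 q₁ hq₁ q₂ hq₂ ab hab
    _ = ∑ q₁ ∈ P₁, ∑ q₂ ∈ P₂, τm ^ 2 * ∑ f ∈ Fs, (cnt f q₁ q₂ : ℝ) :=
        sum_congr rfl fun q₁ _ => sum_congr rfl fun q₂ _ => hg q₁ q₂
    _ = τm ^ 2 * ∑ f ∈ Fs, ∑ q₁ ∈ P₁, ∑ q₂ ∈ P₂, (cnt f q₁ q₂ : ℝ) := by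
        simp only [mul_sum]
        exact (sum_congr rfl fun q₁ _ => sum_comm).trans sum_comm
    _ ≤ τm ^ 2 * ∑ f ∈ Fs, τm ^ 2 * #(box.filter fun ab => Cop ab ∧ f ^ 2 ∣ qn ab) := by
        gcongr with f hf'
        exact hf f hf'
    _ = τm ^ 4 * ∑ f ∈ Fs, (#(box.filter (fun ab => Cop ab ∧ f ^ 2 ∣ qn ab)) : ℝ) := by
        rw [← mul_sum]; ring
    _ ≤ τm ^ 4 * ∑ f ∈ Fs, (M : ℝ) * (#(rootsCube (f ^ 2)) * ((M : ℝ) / ((f ^ 2 : ℕ) : ℝ) + 1)) := by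
        gcongr with f hf'
        rw [hFs, mem_filter, mem_Icc] at hf'
        have hf0 : 0 < f ^ 2 := pow_pos (by omega) 2
        exact card_box_cop_dvd_le hf0 A B M

set_option maxHeartbeats 1600000 in
/-- **Range (β)/(γ) summed** ((7.13)–(7.14)): for a window `P` of primes and any finite `P'`,
`∑_{q∈P} ∑_{q'∈P'} ∑_{ab: cop, q q'∣n} τ(n)² #T_q(n) ≤ τmax⁴ ∑_{q ∈ P} M ρ₃(q²)(M/q² + 1)`.
[cite: HeathBrown2001LargestPrimeFactorCubic, §7 p. 28 ((7.13)–(7.14))] -/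
theorem beta_sum_le {Cd ε : ℝ} (hCd : 0 ≤ Cd) (hε : 0 ≤ ε)
    (hdiv : ∀ n : ℕ, n ≠ 0 → (#n.divisors : ℝ) ≤ Cd * (n : ℝ) ^ ε)
    (P P' : Finset ℕ) (hP : ∀ q ∈ P, q.Prime) (D : ℕ) {A B M L : ℕ} (hAL : A + M ≤ L) (hBL : B + M ≤ L)
    (m : ℕ → ℕ → ℕ) (hm : ∀ q q', q ∣ m q q' ∧ q' ∣ m q q') :
    ∑ q ∈ P, ∑ q' ∈ P', ∑ ab ∈ (Ioc A (A + M) ×ˢ Ioc B (B + M)).filter (fun ab => Cop ab ∧ m q q' ∣ qn ab),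
        (#(qn ab).divisors : ℝ) ^ 2 *
          #((qn ab).divisors.filter fun f => (Real.sqrt D < ((f ^ 2 : ℕ) : ℝ) ∧ f ^ 2 ∣ qn ab) ∧ q ∣ f) ≤
      (Cd * (3 * (L : ℝ) ^ 3) ^ ε) ^ 4 * ∑ q ∈ P, (M : ℝ) * (#(rootsCube (q ^ 2)) * ((M : ℝ) / ((q ^ 2 : ℕ) : ℝ) + 1)) := by
  classical
  set box := Ioc A (A + M) ×ˢ Ioc B (B + M) with hbox
  set τm : ℝ := Cd * (3 * (L : ℝ) ^ 3) ^ ε with hτm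
  have hτm0 : 0 ≤ τm := by positivity
  have hbnd : ∀ ab ∈ box, qn ab ≠ 0 ∧ (qn ab : ℝ) ≤ 3 * (L : ℝ) ^ 3 ∧ (#(qn ab).divisors : ℝ) ≤ τm :=
    fun ab hab => tau_le_of_mem_box hCd hε hdiv hAL hBL hab
  rw [mul_sum]
  refine sum_le_sum fun q hq => ?_
  have hq0 : 0 < q ^ 2 := pow_pos (hP q hq).pos 2
  -- per `q`: `∑_{q'} ∑_{ab: cop, m∣n} τ² #T_q ≤ ∑_{q'} ∑_{ab: (cop ∧ q²∣n) ∧ q' ∣ n} τm³`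
  calc ∑ q' ∈ P', ∑ ab ∈ box.filter (fun ab => Cop ab ∧ m q q' ∣ qn ab),
        (#(qn ab).divisors : ℝ) ^ 2 *
          #((qn ab).divisors.filter fun f => (Real.sqrt D < ((f ^ 2 : ℕ) : ℝ) ∧ f ^ 2 ∣ qn ab) ∧ q ∣ f)
      ≤ ∑ q' ∈ P', ∑ ab ∈ box.filter (fun ab => (Cop ab ∧ q ^ 2 ∣ qn ab) ∧ (fun q' => q') q' ∣ qn ab), τm ^ 3 := by
        refine sum_le_sum fun q' _ => ?_
        -- compare termwise via an `if`
        have h1 : ∀ ab ∈ box.filter (fun ab => Cop ab ∧ m q q' ∣ qn ab),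
            (#(qn ab).divisors : ℝ) ^ 2 *
              #((qn ab).divisors.filter fun f => (Real.sqrt D < ((f ^ 2 : ℕ) : ℝ) ∧ f ^ 2 ∣ qn ab) ∧ q ∣ f) ≤
            if q ^ 2 ∣ qn ab then τm ^ 3 else 0 := by
          intro ab hab
          rw [mem_filter] at hab
          obtain ⟨hn0, -, hτ⟩ := hbnd ab hab.1
          have hT := card_Tq_le (n := qn ab) (D := D) (q := q)
          split_ifs with h
          · rw [if_pos h] at hT
            calc (#(qn ab).divisors : ℝ) ^ 2 * _ ≤ τm ^ 2 * τm :=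
                  mul_le_mul (pow_le_pow_left₀ (Nat.cast_nonneg _) hτ 2) (hT.trans hτ) (Nat.cast_nonneg _) (by positivity)
              _ = τm ^ 3 := by ring
          · rw [if_neg h] at hT
            have : (#((qn ab).divisors.filter fun f => (Real.sqrt D < ((f ^ 2 : ℕ) : ℝ) ∧ f ^ 2 ∣ qn ab) ∧ q ∣ f) : ℝ) = 0 :=
              le_antisymm hT (Nat.cast_nonneg _)
            rw [this, mul_zero]
        refine (sum_le_sum h1).trans ?_
        rw [← sum_filter]
        refine sum_le_sum_of_subset_of_nonneg ?_ (fun _ _ _ => by positivity)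
        intro ab hab
        rw [mem_filter, mem_filter] at hab
        rw [mem_filter]
        exact ⟨hab.1.1, ⟨hab.1.2.1, hab.2⟩, (hm q q').2.trans hab.1.2.2⟩
    _ = ∑ ab ∈ box.filter (fun ab => Cop ab ∧ q ^ 2 ∣ qn ab), τm ^ 3 * #(P'.filter fun q' : ℕ => q' ∣ qn ab) :=
        sum_filter_eq_single P' box (fun ab => Cop ab ∧ q ^ 2 ∣ qn ab) (fun q' => q') (fun _ => τm ^ 3)
    _ ≤ ∑ _ab ∈ box.filter (fun ab => Cop ab ∧ q ^ 2 ∣ qn ab), τm ^ 3 * τm := by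
        refine sum_le_sum fun ab hab => ?_
        rw [mem_filter] at hab
        obtain ⟨hn0, -, hτ⟩ := hbnd ab hab.1
        refine mul_le_mul_of_nonneg_left ?_ (by positivity)
        calc (#(P'.filter fun q' : ℕ => q' ∣ qn ab) : ℝ) ≤ #(qn ab).divisors := by exact_mod_cast card_filter_dvd_le P' hn0
          _ ≤ τm := hτ
    _ = τm ^ 4 * (#(box.filter (fun ab => Cop ab ∧ q ^ 2 ∣ qn ab)) : ℝ) := by rw [sum_const, nsmul_eq_mul]; ring
    _ ≤ τm ^ 4 * ((M : ℝ) * (#(rootsCube (q ^ 2)) * ((M : ℝ) / ((q ^ 2 : ℕ) : ℝ) + 1))) := by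
        gcongr
        exact card_box_cop_dvd_le hq0 A B M


/-! ### Assembly -/

/-- `∑_{f ∈ Fs} 1/f² ≤ 2/D^{1/4}`: the `f` with `f² > √D` exceed `⌊D^{1/4}⌋`. [folklore] -/
theorem sum_Fs_inv_sq_le {D F : ℕ} (hD : 1 ≤ D) :
    ∑ f ∈ (Icc 1 F).filter (fun f => Real.sqrt D < ((f ^ 2 : ℕ) : ℝ)), (1 : ℝ) / ((f ^ 2 : ℕ) : ℝ) ≤
      2 / (D : ℝ) ^ ((1 : ℝ) / 4) := by
  have hD0 : (0 : ℝ) < D := by exact_mod_cast hD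
  have hD1 : (1 : ℝ) ≤ D := by exact_mod_cast hD
  set x : ℝ := (D : ℝ) ^ ((1 : ℝ) / 4) with hx
  have hx1 : 1 ≤ x := Real.one_le_rpow hD1 (by norm_num)
  have hx0 : 0 < x := by linarith
  have hxsq : x ^ 2 = Real.sqrt D := by
    rw [hx, ← Real.rpow_natCast, ← Real.rpow_mul hD0.le, Real.sqrt_eq_rpow]; norm_num
  have hfl1 : 1 ≤ ⌊x⌋₊ := Nat.le_floor (by simpa using hx1)
  have hsub : (Icc 1 F).filter (fun f => Real.sqrt D < ((f ^ 2 : ℕ) : ℝ)) ⊆ Ioc ⌊x⌋₊ F := by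
    intro f hf
    rw [mem_filter, mem_Icc] at hf
    rw [mem_Ioc]
    refine ⟨?_, hf.1.2⟩
    by_contra hle
    rw [not_lt] at hle
    have hfx : (f : ℝ) ≤ x := (Nat.cast_le.mpr hle).trans (Nat.floor_le hx0.le)
    have : ((f ^ 2 : ℕ) : ℝ) ≤ Real.sqrt D := by
      push_cast; rw [← hxsq]; exact pow_le_pow_left₀ (Nat.cast_nonneg _) hfx 2
    linarith [hf.2]
  calc ∑ f ∈ (Icc 1 F).filter (fun f => Real.sqrt D < ((f ^ 2 : ℕ) : ℝ)), (1 : ℝ) / ((f ^ 2 : ℕ) : ℝ)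
      ≤ ∑ f ∈ Ioc ⌊x⌋₊ F, (1 : ℝ) / ((f ^ 2 : ℕ) : ℝ) :=
        sum_le_sum_of_subset_of_nonneg hsub fun _ _ _ => by positivity
    _ = ∑ f ∈ Ioc ⌊x⌋₊ F, (1 : ℝ) / (f : ℝ) ^ 2 := sum_congr rfl fun f _ => by push_cast; ring
    _ ≤ 1 / (⌊x⌋₊ : ℝ) := sum_Ioc_inv_sq_le hfl1 F
    _ ≤ 1 / (x / 2) := one_div_le_one_div_of_le (by positivity) (half_le_nat_floor hx1)
    _ = 2 / x := by field_simp

/-- `∑_{q ∈ P} 1/q² ≤ 1/Q` for `P ⊆ (Q, L]`. [folklore] -/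
theorem sum_window_inv_sq_le {P : Finset ℕ} {Q L : ℕ} (hQ : 1 ≤ Q) (hP : ∀ q ∈ P, Q < q ∧ q ≤ L) :
    ∑ q ∈ P, (1 : ℝ) / ((q ^ 2 : ℕ) : ℝ) ≤ 1 / (Q : ℝ) := by
  have hsub : P ⊆ Ioc Q L := fun q hq => mem_Ioc.mpr (hP q hq)
  calc ∑ q ∈ P, (1 : ℝ) / ((q ^ 2 : ℕ) : ℝ) ≤ ∑ q ∈ Ioc Q L, (1 : ℝ) / ((q ^ 2 : ℕ) : ℝ) :=
        sum_le_sum_of_subset_of_nonneg hsub fun _ _ _ => by positivity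
    _ = ∑ q ∈ Ioc Q L, (1 : ℝ) / (q : ℝ) ^ 2 := sum_congr rfl fun q _ => by push_cast; ring
    _ ≤ 1 / (Q : ℝ) := sum_Ioc_inv_sq_le hQ L

set_option maxHeartbeats 4000000 in
/-- **The tail (7.8)–(7.14)**: for every `ε > 0` there is `C > 0` such that for all prime windows
`P₁ ⊆ (Q₁, L]`, `P₂ ⊆ (Q₂, L]`, thresholds `D ≥ 1` and boxes `(A,A+M]×(B,B+M]` with `A+M, B+M ≤ L`,
`∑_{q₁,q₂} ∑_{(a,b) coprime, q₁q₂ ∣ n} ∑_{d∣n, d≥D} |l(d)| ≤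
C L^ε (M²/D^{1/4} + M√(3L³/(Q₁Q₂)) + M²/Q₁ + M #P₁ + M²/Q₂ + M #P₂)`, `n = |a³ − 2b³|`.
[cite: HeathBrown2001LargestPrimeFactorCubic, §7 pp. 27–28 ((7.8)–(7.14))] -/
theorem tail_sum_le {ε : ℝ} (hε : 0 < ε) : ∃ C : ℝ, 0 < C ∧
    ∀ (P₁ P₂ : Finset ℕ) (Q₁ Q₂ D A B M L : ℕ),
      (∀ q ∈ P₁, q.Prime ∧ Q₁ < q ∧ q ≤ L) → (∀ q ∈ P₂, q.Prime ∧ Q₂ < q ∧ q ≤ L) →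
      1 ≤ Q₁ → 1 ≤ Q₂ → 1 ≤ D → A + M ≤ L → B + M ≤ L → 1 ≤ L →
      ∑ q₁ ∈ P₁, ∑ q₂ ∈ P₂, ∑ ab ∈ (Ioc A (A + M) ×ˢ Ioc B (B + M)).filter (fun ab => Cop ab ∧ q₁ * q₂ ∣ qn ab),
          ∑ d ∈ (qn ab).divisors.filter (fun d => D ≤ d), |lFun d| ≤
        C * (L : ℝ) ^ ε * ((M : ℝ) ^ 2 / (D : ℝ) ^ ((1 : ℝ) / 4) + M * Real.sqrt (3 * (L : ℝ) ^ 3 / ((Q₁ : ℝ) * Q₂)) +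
          (M : ℝ) ^ 2 / Q₁ + M * #P₁ + (M : ℝ) ^ 2 / Q₂ + M * #P₂) := by
  classical
  set ε₀ : ℝ := ε / 20 with hε₀
  have hε₀0 : 0 < ε₀ := by positivity
  obtain ⟨Cd, hCd1, hCd⟩ := exists_card_divisors_le_mul_rpow hε₀0
  obtain ⟨Cr, hCr1, hCr⟩ := exists_card_rootsCube_le_rpow hε₀0
  have hCd0 : 0 ≤ Cd := by linarith
  have hCr0 : 0 ≤ Cr := by linarith
  have h3pos : (0 : ℝ) < (3 : ℝ) ^ (5 * ε₀) := Real.rpow_pos_of_pos (by norm_num) _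
  set K : ℝ := 3 * (Cd ^ 5 + Cd ^ 4 * Cr) * (3 : ℝ) ^ (5 * ε₀) with hK
  have hK0 : 0 < K := by rw [hK]; positivity
  refine ⟨K, hK0, ?_⟩
  intro P₁ P₂ Q₁ Q₂ D A B M L hP₁ hP₂ hQ₁ hQ₂ hD hAL hBL hL
  set box := Ioc A (A + M) ×ˢ Ioc B (B + M) with hbox
  set τm : ℝ := Cd * (3 * (L : ℝ) ^ 3) ^ ε₀ with hτm
  set ρm : ℝ := Cr * (3 * (L : ℝ) ^ 3) ^ ε₀ with hρm
  have hL0 : (0 : ℝ) < L := by exact_mod_cast hL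
  have hL1 : (1 : ℝ) ≤ L := by exact_mod_cast hL
  have h3L : (1 : ℝ) ≤ 3 * (L : ℝ) ^ 3 := by nlinarith [one_le_pow₀ (n := 3) hL1]
  have hpow1 : (1 : ℝ) ≤ (3 * (L : ℝ) ^ 3) ^ ε₀ := Real.one_le_rpow h3L hε₀0.le
  have hτm1 : 1 ≤ τm := one_le_mul_of_one_le_of_one_le hCd1 hpow1
  have hρm1 : 1 ≤ ρm := one_le_mul_of_one_le_of_one_le hCr1 hpow1
  have hτm0 : 0 ≤ τm := by linarith
  have hρm0 : 0 ≤ ρm := by linarith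
  have hD0 : (0 : ℝ) < D := by exact_mod_cast hD
  have hsD : 0 < Real.sqrt D := Real.sqrt_pos.mpr hD0
  have hD4 : 0 < (D : ℝ) ^ ((1 : ℝ) / 4) := Real.rpow_pos_of_pos hD0 _
  have hbnd : ∀ ab ∈ box, qn ab ≠ 0 ∧ (qn ab : ℝ) ≤ 3 * (L : ℝ) ^ 3 ∧ (#(qn ab).divisors : ℝ) ≤ τm :=
    fun ab hab => tau_le_of_mem_box hCd0 hε₀0.le hCd hAL hBL hab
  have hP₁' : ∀ q ∈ P₁, q.Prime ∧ Q₁ < q := fun q hq => ⟨(hP₁ q hq).1, (hP₁ q hq).2.1⟩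
  have hP₂' : ∀ q ∈ P₂, q.Prime ∧ Q₂ < q := fun q hq => ⟨(hP₂ q hq).1, (hP₂ q hq).2.1⟩
  -- ρ₃ bounds
  have hρf : ∀ f ∈ (Icc 1 ⌊Real.sqrt (3 * (L : ℝ) ^ 3 / ((Q₁ : ℝ) * Q₂))⌋₊).filter
      (fun f => Real.sqrt D < ((f ^ 2 : ℕ) : ℝ)), (#(rootsCube (f ^ 2)) : ℝ) ≤ ρm := by
    intro f hf
    rw [mem_filter, mem_Icc] at hf
    have hf0 : f ^ 2 ≠ 0 := pow_ne_zero 2 (by omega)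
    refine (hCr _ hf0).trans ?_
    rw [hρm]
    refine mul_le_mul_of_nonneg_left (Real.rpow_le_rpow (Nat.cast_nonneg _) ?_ hε₀0.le) hCr0
    -- `f ≤ ⌊√(3L³/(Q₁Q₂))⌋` so `f² ≤ 3L³/(Q₁Q₂) ≤ 3L³`
    have hQ : (1 : ℝ) ≤ (Q₁ : ℝ) * Q₂ := by
      have : 1 ≤ Q₁ * Q₂ := Nat.one_le_iff_ne_zero.mpr (Nat.mul_ne_zero (by omega) (by omega))
      exact_mod_cast this
    have hfle : (f : ℝ) ≤ Real.sqrt (3 * (L : ℝ) ^ 3 / ((Q₁ : ℝ) * Q₂)) :=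
      (Nat.cast_le.mpr hf.1.2).trans (Nat.floor_le (Real.sqrt_nonneg _))
    have hf2 : (f : ℝ) ^ 2 ≤ 3 * (L : ℝ) ^ 3 / ((Q₁ : ℝ) * Q₂) := by
      calc (f : ℝ) ^ 2 ≤ Real.sqrt (3 * (L : ℝ) ^ 3 / ((Q₁ : ℝ) * Q₂)) ^ 2 := pow_le_pow_left₀ (Nat.cast_nonneg _) hfle 2
        _ = 3 * (L : ℝ) ^ 3 / ((Q₁ : ℝ) * Q₂) := Real.sq_sqrt (by positivity)
    have : 3 * (L : ℝ) ^ 3 / ((Q₁ : ℝ) * Q₂) ≤ 3 * (L : ℝ) ^ 3 := div_le_self (by positivity) hQ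
    push_cast; linarith
  have hρq : ∀ (P : Finset ℕ) (Q : ℕ), (∀ q ∈ P, q.Prime ∧ Q < q ∧ q ≤ L) → ∀ q ∈ P, (#(rootsCube (q ^ 2)) : ℝ) ≤ ρm := by
    intro P Q hP q hq
    obtain ⟨hqP, -, hqL⟩ := hP q hq
    refine (hCr _ (pow_ne_zero 2 hqP.ne_zero)).trans ?_
    rw [hρm]
    refine mul_le_mul_of_nonneg_left (Real.rpow_le_rpow (Nat.cast_nonneg _) ?_ hε₀0.le) hCr0
    have : (q : ℝ) ≤ L := by exact_mod_cast hqL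
    have hq0 : (0 : ℝ) ≤ q := Nat.cast_nonneg _
    push_cast; nlinarith [pow_le_pow_left₀ hq0 this 2]
  -- Step A: per term, split `∑_{d ≥ D} |l d|`
  have hA : ∀ q₁ ∈ P₁, ∀ q₂ ∈ P₂, ∀ ab ∈ box.filter (fun ab => Cop ab ∧ q₁ * q₂ ∣ qn ab),
      ∑ d ∈ (qn ab).divisors.filter (fun d => D ≤ d), |lFun d| ≤
        (#(qn ab).divisors : ℝ) ^ 3 / Real.sqrt D +
        ((#(qn ab).divisors : ℝ) ^ 2 *
            #((qn ab).divisors.filter fun f => (Real.sqrt D < ((f ^ 2 : ℕ) : ℝ) ∧ f ^ 2 ∣ qn ab) ∧ Nat.Coprime f (q₁ * q₂)) +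
          (#(qn ab).divisors : ℝ) ^ 2 *
            #((qn ab).divisors.filter fun f => (Real.sqrt D < ((f ^ 2 : ℕ) : ℝ) ∧ f ^ 2 ∣ qn ab) ∧ q₁ ∣ f) +
          (#(qn ab).divisors : ℝ) ^ 2 *
            #((qn ab).divisors.filter fun f => (Real.sqrt D < ((f ^ 2 : ℕ) : ℝ) ∧ f ^ 2 ∣ qn ab) ∧ q₂ ∣ f)) := by
    intro q₁ hq₁ q₂ hq₂ ab hab
    rw [mem_filter] at hab
    obtain ⟨hn0, -, -⟩ := hbnd ab hab.1
    have h1 := sum_divisors_ge_abs_lFun_le hn0 hD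
    have h2 := card_filter_radTwo_le (D := D) hn0
    have h3 := card_T_le_three (qn ab) D (hP₁ q₁ hq₁).1 (hP₂ q₂ hq₂).1
    have h2' : (#((qn ab).divisors.filter fun d => lFun d ≠ 0 ∧ Real.sqrt D < ((radTwo d ^ 2 : ℕ) : ℝ)) : ℝ) ≤
        #(qn ab).divisors * (#((qn ab).divisors.filter fun f => Real.sqrt D < ((f ^ 2 : ℕ) : ℝ) ∧ f ^ 2 ∣ qn ab) : ℝ) := by
      exact_mod_cast h2
    have h3' : (#((qn ab).divisors.filter fun f => Real.sqrt D < ((f ^ 2 : ℕ) : ℝ) ∧ f ^ 2 ∣ qn ab) : ℝ) ≤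
        #((qn ab).divisors.filter fun f => (Real.sqrt D < ((f ^ 2 : ℕ) : ℝ) ∧ f ^ 2 ∣ qn ab) ∧ Nat.Coprime f (q₁ * q₂)) +
        #((qn ab).divisors.filter fun f => (Real.sqrt D < ((f ^ 2 : ℕ) : ℝ) ∧ f ^ 2 ∣ qn ab) ∧ q₁ ∣ f) +
        #((qn ab).divisors.filter fun f => (Real.sqrt D < ((f ^ 2 : ℕ) : ℝ) ∧ f ^ 2 ∣ qn ab) ∧ q₂ ∣ f) := by
      exact_mod_cast h3
    have hτ0 : (0 : ℝ) ≤ #(qn ab).divisors := Nat.cast_nonneg _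
    have key : (#(qn ab).divisors : ℝ) * #((qn ab).divisors.filter fun d => lFun d ≠ 0 ∧ Real.sqrt D < ((radTwo d ^ 2 : ℕ) : ℝ)) ≤
        (#(qn ab).divisors : ℝ) ^ 2 *
          (#((qn ab).divisors.filter fun f => (Real.sqrt D < ((f ^ 2 : ℕ) : ℝ) ∧ f ^ 2 ∣ qn ab) ∧ Nat.Coprime f (q₁ * q₂)) +
           #((qn ab).divisors.filter fun f => (Real.sqrt D < ((f ^ 2 : ℕ) : ℝ) ∧ f ^ 2 ∣ qn ab) ∧ q₁ ∣ f) +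
           #((qn ab).divisors.filter fun f => (Real.sqrt D < ((f ^ 2 : ℕ) : ℝ) ∧ f ^ 2 ∣ qn ab) ∧ q₂ ∣ f)) := by
      calc _ ≤ (#(qn ab).divisors : ℝ) * (#(qn ab).divisors * (#((qn ab).divisors.filter fun f => Real.sqrt D < ((f ^ 2 : ℕ) : ℝ) ∧ f ^ 2 ∣ qn ab) : ℝ)) :=
            mul_le_mul_of_nonneg_left h2' hτ0
        _ = (#(qn ab).divisors : ℝ) ^ 2 * #((qn ab).divisors.filter fun f => Real.sqrt D < ((f ^ 2 : ℕ) : ℝ) ∧ f ^ 2 ∣ qn ab) := by ring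
        _ ≤ _ := mul_le_mul_of_nonneg_left h3' (by positivity)
    linarith
  -- Step B: sum Step A and split into four sums
  have hB := sum_le_sum fun q₁ hq₁ => sum_le_sum fun q₂ hq₂ => sum_le_sum fun ab hab => hA q₁ hq₁ q₂ hq₂ ab hab
  refine hB.trans ?_
  simp only [sum_add_distrib, mul_add]
  -- the four pieces
  have hα := alpha_sum_le hCd0 hε₀0.le hCd P₁ P₂ hP₁' hP₂' hQ₁ hQ₂ D hAL hBL
  have hβ := beta_sum_le hCd0 hε₀0.le hCd P₁ P₂ (fun q hq => (hP₁ q hq).1) D hAL hBL (fun q q' => q * q')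
    (fun q q' => ⟨dvd_mul_right q q', dvd_mul_left q' q⟩)
  have hγ' := beta_sum_le hCd0 hε₀0.le hCd P₂ P₁ (fun q hq => (hP₂ q hq).1) D hAL hBL (fun q q' => q' * q)
    (fun q q' => ⟨dvd_mul_left q q', dvd_mul_right q' q⟩)
  have hγ : ∑ q₁ ∈ P₁, ∑ q₂ ∈ P₂, ∑ ab ∈ box.filter (fun ab => Cop ab ∧ q₁ * q₂ ∣ qn ab),
      (#(qn ab).divisors : ℝ) ^ 2 *
        #((qn ab).divisors.filter fun f => (Real.sqrt D < ((f ^ 2 : ℕ) : ℝ) ∧ f ^ 2 ∣ qn ab) ∧ q₂ ∣ f) ≤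
      τm ^ 4 * ∑ q ∈ P₂, (M : ℝ) * (#(rootsCube (q ^ 2)) * ((M : ℝ) / ((q ^ 2 : ℕ) : ℝ) + 1)) := by
    rw [sum_comm]; exact hγ'
  -- the `τ³/√D` piece
  have h0 : ∑ q₁ ∈ P₁, ∑ q₂ ∈ P₂, ∑ ab ∈ box.filter (fun ab => Cop ab ∧ q₁ * q₂ ∣ qn ab),
      (#(qn ab).divisors : ℝ) ^ 3 / Real.sqrt D ≤ (M : ℝ) ^ 2 * τm ^ 5 / Real.sqrt D := by
    rw [sum_sum_filter_eq P₁ P₂ box Cop]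
    calc ∑ ab ∈ box.filter Cop, (#(qn ab).divisors : ℝ) ^ 3 / Real.sqrt D * #((P₁ ×ˢ P₂).filter fun q : ℕ × ℕ => q.1 * q.2 ∣ qn ab)
        ≤ ∑ _ab ∈ box.filter Cop, τm ^ 5 / Real.sqrt D := by
          refine sum_le_sum fun ab hab => ?_
          rw [mem_filter] at hab
          obtain ⟨hn0, -, hτ⟩ := hbnd ab hab.1
          have hp : (#((P₁ ×ˢ P₂).filter fun q : ℕ × ℕ => q.1 * q.2 ∣ qn ab) : ℝ) ≤ τm ^ 2 :=
            le_trans (by exact_mod_cast card_pairs_dvd_le P₁ P₂ hn0) (pow_le_pow_left₀ (Nat.cast_nonneg _) hτ 2)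
          have h3 : (#(qn ab).divisors : ℝ) ^ 3 ≤ τm ^ 3 := pow_le_pow_left₀ (Nat.cast_nonneg _) hτ 3
          calc (#(qn ab).divisors : ℝ) ^ 3 / Real.sqrt D * #((P₁ ×ˢ P₂).filter fun q : ℕ × ℕ => q.1 * q.2 ∣ qn ab)
              ≤ τm ^ 3 / Real.sqrt D * τm ^ 2 := by
                apply mul_le_mul (div_le_div_of_nonneg_right h3 hsD.le) hp (Nat.cast_nonneg _) (by positivity)
            _ = τm ^ 5 / Real.sqrt D := by ring
      _ = #(box.filter Cop) * (τm ^ 5 / Real.sqrt D) := by rw [sum_const, nsmul_eq_mul]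
      _ ≤ (M : ℝ) ^ 2 * (τm ^ 5 / Real.sqrt D) := by
          gcongr
          have : #(box.filter Cop) ≤ M ^ 2 := by
            calc #(box.filter Cop) ≤ #box := card_le_card (filter_subset _ _)
              _ = M ^ 2 := by rw [hbox, card_product, Nat.card_Ioc, Nat.card_Ioc]; simp [sq]
          exact_mod_cast this
      _ = (M : ℝ) ^ 2 * τm ^ 5 / Real.sqrt D := by ring
  -- evaluate the (α) and (β)/(γ) right-hand sides
  set Fs := (Icc 1 ⌊Real.sqrt (3 * (L : ℝ) ^ 3 / ((Q₁ : ℝ) * Q₂))⌋₊).filter (fun f => Real.sqrt D < ((f ^ 2 : ℕ) : ℝ)) with hFs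
  have hαR : ∑ f ∈ Fs, (M : ℝ) * (#(rootsCube (f ^ 2)) * ((M : ℝ) / ((f ^ 2 : ℕ) : ℝ) + 1)) ≤
      (M : ℝ) * ρm * (M * (2 / (D : ℝ) ^ ((1 : ℝ) / 4)) + Real.sqrt (3 * (L : ℝ) ^ 3 / ((Q₁ : ℝ) * Q₂))) := by
    calc ∑ f ∈ Fs, (M : ℝ) * (#(rootsCube (f ^ 2)) * ((M : ℝ) / ((f ^ 2 : ℕ) : ℝ) + 1))
        ≤ ∑ f ∈ Fs, (M : ℝ) * (ρm * ((M : ℝ) / ((f ^ 2 : ℕ) : ℝ) + 1)) := by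
          refine sum_le_sum fun f hf => ?_
          gcongr
          exact hρf f hf
      _ = ∑ f ∈ Fs, ((M : ℝ) * ρm * M * (1 / ((f ^ 2 : ℕ) : ℝ)) + (M : ℝ) * ρm) := sum_congr rfl fun f _ => by ring
      _ = (M : ℝ) * ρm * (M * ∑ f ∈ Fs, 1 / ((f ^ 2 : ℕ) : ℝ) + #Fs) := by
          rw [sum_add_distrib, ← mul_sum, sum_const, nsmul_eq_mul]; ring
      _ ≤ (M : ℝ) * ρm * (M * (2 / (D : ℝ) ^ ((1 : ℝ) / 4)) + Real.sqrt (3 * (L : ℝ) ^ 3 / ((Q₁ : ℝ) * Q₂))) := by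
          gcongr
          · exact sum_Fs_inv_sq_le hD
          · calc (#Fs : ℝ) ≤ #(Icc 1 ⌊Real.sqrt (3 * (L : ℝ) ^ 3 / ((Q₁ : ℝ) * Q₂))⌋₊) := by
                  exact Nat.cast_le.mpr (card_le_card (by rw [hFs]; exact filter_subset _ _))
              _ = ⌊Real.sqrt (3 * (L : ℝ) ^ 3 / ((Q₁ : ℝ) * Q₂))⌋₊ := by rw [Nat.card_Icc]; push_cast; ring
              _ ≤ Real.sqrt (3 * (L : ℝ) ^ 3 / ((Q₁ : ℝ) * Q₂)) := Nat.floor_le (Real.sqrt_nonneg _)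
  have hβR : ∀ (P : Finset ℕ) (Q : ℕ), 1 ≤ Q → (∀ q ∈ P, q.Prime ∧ Q < q ∧ q ≤ L) →
      ∑ q ∈ P, (M : ℝ) * (#(rootsCube (q ^ 2)) * ((M : ℝ) / ((q ^ 2 : ℕ) : ℝ) + 1)) ≤ (M : ℝ) * ρm * (M * (1 / (Q : ℝ)) + #P) := by
    intro P Q hQ hP
    calc ∑ q ∈ P, (M : ℝ) * (#(rootsCube (q ^ 2)) * ((M : ℝ) / ((q ^ 2 : ℕ) : ℝ) + 1))
        ≤ ∑ q ∈ P, (M : ℝ) * (ρm * ((M : ℝ) / ((q ^ 2 : ℕ) : ℝ) + 1)) := by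
          refine sum_le_sum fun q hq => ?_
          gcongr
          exact hρq P Q hP q hq
      _ = ∑ q ∈ P, ((M : ℝ) * ρm * M * (1 / ((q ^ 2 : ℕ) : ℝ)) + (M : ℝ) * ρm) := sum_congr rfl fun q _ => by ring
      _ = (M : ℝ) * ρm * (M * ∑ q ∈ P, 1 / ((q ^ 2 : ℕ) : ℝ) + #P) := by
          rw [sum_add_distrib, ← mul_sum, sum_const, nsmul_eq_mul]; ring
      _ ≤ (M : ℝ) * ρm * (M * (1 / (Q : ℝ)) + #P) := by
          gcongr
          exact sum_window_inv_sq_le hQ fun q hq => ⟨(hP q hq).2.1, (hP q hq).2.2⟩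
  have hβR₁ := hβR P₁ Q₁ hQ₁ hP₁
  have hβR₂ := hβR P₂ Q₂ hQ₂ hP₂
  -- constants: `τm⁵ ≤ Cd⁵ 3^{5ε₀} L^ε`, `τm⁴ ρm ≤ Cd⁴ Cr 3^{5ε₀} L^ε`
  have hpow : ((3 * (L : ℝ) ^ 3) ^ ε₀) ^ 5 ≤ (3 : ℝ) ^ (5 * ε₀) * (L : ℝ) ^ ε := by
    rw [← Real.rpow_natCast, ← Real.rpow_mul (by positivity), Real.mul_rpow (by norm_num) (by positivity),
      ← Real.rpow_natCast (L : ℝ) 3, ← Real.rpow_mul hL0.le]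
    push_cast
    rw [show ε₀ * 5 = 5 * ε₀ by ring]
    refine mul_le_mul_of_nonneg_left (Real.rpow_le_rpow_of_exponent_le hL1 ?_) h3pos.le
    rw [hε₀]; linarith
  have hτ5 : τm ^ 5 ≤ Cd ^ 5 * ((3 : ℝ) ^ (5 * ε₀) * (L : ℝ) ^ ε) := by
    rw [hτm, mul_pow]; exact mul_le_mul_of_nonneg_left hpow (by positivity)
  have hτ4ρ : τm ^ 4 * ρm ≤ Cd ^ 4 * Cr * ((3 : ℝ) ^ (5 * ε₀) * (L : ℝ) ^ ε) := by
    rw [hτm, hρm, mul_pow]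
    calc Cd ^ 4 * ((3 * (L : ℝ) ^ 3) ^ ε₀) ^ 4 * (Cr * (3 * (L : ℝ) ^ 3) ^ ε₀)
        = Cd ^ 4 * Cr * ((3 * (L : ℝ) ^ 3) ^ ε₀) ^ 5 := by ring
      _ ≤ Cd ^ 4 * Cr * ((3 : ℝ) ^ (5 * ε₀) * (L : ℝ) ^ ε) := mul_le_mul_of_nonneg_left hpow (by positivity)
  -- `1/√D ≤ 1/D^{1/4}`
  have hsqrt4 : 1 / Real.sqrt D ≤ 1 / (D : ℝ) ^ ((1 : ℝ) / 4) := by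
    apply one_div_le_one_div_of_le hD4
    rw [Real.sqrt_eq_rpow]
    exact Real.rpow_le_rpow_of_exponent_le (by exact_mod_cast hD) (by norm_num)
  -- collect
  have hM0 : (0 : ℝ) ≤ M := Nat.cast_nonneg M
  set Lε := (L : ℝ) ^ ε with hLε
  have hLε0 : 0 ≤ Lε := by positivity
  set SQ := Real.sqrt (3 * (L : ℝ) ^ 3 / ((Q₁ : ℝ) * Q₂)) with hSQ
  have hSQ0 : 0 ≤ SQ := Real.sqrt_nonneg _
  have e1 : (M : ℝ) ^ 2 * τm ^ 5 / Real.sqrt D ≤ Cd ^ 5 * (3 : ℝ) ^ (5 * ε₀) * Lε * ((M : ℝ) ^ 2 / (D : ℝ) ^ ((1 : ℝ) / 4)) := by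
    calc (M : ℝ) ^ 2 * τm ^ 5 / Real.sqrt D = (M : ℝ) ^ 2 * τm ^ 5 * (1 / Real.sqrt D) := by ring
      _ ≤ (M : ℝ) ^ 2 * (Cd ^ 5 * ((3 : ℝ) ^ (5 * ε₀) * Lε)) * (1 / (D : ℝ) ^ ((1 : ℝ) / 4)) := by
          gcongr
      _ = _ := by ring
  have e2 : τm ^ 4 * ∑ f ∈ Fs, (M : ℝ) * (#(rootsCube (f ^ 2)) * ((M : ℝ) / ((f ^ 2 : ℕ) : ℝ) + 1)) ≤
      Cd ^ 4 * Cr * (3 : ℝ) ^ (5 * ε₀) * Lε * (2 * ((M : ℝ) ^ 2 / (D : ℝ) ^ ((1 : ℝ) / 4)) + M * SQ) := by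
    calc τm ^ 4 * ∑ f ∈ Fs, (M : ℝ) * (#(rootsCube (f ^ 2)) * ((M : ℝ) / ((f ^ 2 : ℕ) : ℝ) + 1))
        ≤ τm ^ 4 * ((M : ℝ) * ρm * (M * (2 / (D : ℝ) ^ ((1 : ℝ) / 4)) + SQ)) := mul_le_mul_of_nonneg_left hαR (by positivity)
      _ = (τm ^ 4 * ρm) * ((M : ℝ) * (M * (2 / (D : ℝ) ^ ((1 : ℝ) / 4)) + SQ)) := by ring
      _ ≤ (Cd ^ 4 * Cr * ((3 : ℝ) ^ (5 * ε₀) * Lε)) * ((M : ℝ) * (M * (2 / (D : ℝ) ^ ((1 : ℝ) / 4)) + SQ)) :=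
          mul_le_mul_of_nonneg_right hτ4ρ (by positivity)
      _ = _ := by ring
  have e3 : ∀ (P : Finset ℕ) (Q : ℕ), ∑ q ∈ P, (M : ℝ) * (#(rootsCube (q ^ 2)) * ((M : ℝ) / ((q ^ 2 : ℕ) : ℝ) + 1)) ≤
      (M : ℝ) * ρm * (M * (1 / (Q : ℝ)) + #P) →
      τm ^ 4 * ∑ q ∈ P, (M : ℝ) * (#(rootsCube (q ^ 2)) * ((M : ℝ) / ((q ^ 2 : ℕ) : ℝ) + 1)) ≤
        Cd ^ 4 * Cr * (3 : ℝ) ^ (5 * ε₀) * Lε * ((M : ℝ) ^ 2 / Q + M * #P) := by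
    intro P Q h
    calc τm ^ 4 * ∑ q ∈ P, (M : ℝ) * (#(rootsCube (q ^ 2)) * ((M : ℝ) / ((q ^ 2 : ℕ) : ℝ) + 1))
        ≤ τm ^ 4 * ((M : ℝ) * ρm * (M * (1 / (Q : ℝ)) + #P)) := mul_le_mul_of_nonneg_left h (by positivity)
      _ = (τm ^ 4 * ρm) * ((M : ℝ) * (M * (1 / (Q : ℝ)) + #P)) := by ring
      _ ≤ (Cd ^ 4 * Cr * ((3 : ℝ) ^ (5 * ε₀) * Lε)) * ((M : ℝ) * (M * (1 / (Q : ℝ)) + #P)) :=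
          mul_le_mul_of_nonneg_right hτ4ρ (by positivity)
      _ = _ := by ring
  have e3₁ := e3 P₁ Q₁ hβR₁
  have e3₂ := e3 P₂ Q₂ hβR₂
  have hfinal : (M : ℝ) ^ 2 * τm ^ 5 / Real.sqrt D +
      (τm ^ 4 * ∑ f ∈ Fs, (M : ℝ) * (#(rootsCube (f ^ 2)) * ((M : ℝ) / ((f ^ 2 : ℕ) : ℝ) + 1)) +
       τm ^ 4 * ∑ q ∈ P₁, (M : ℝ) * (#(rootsCube (q ^ 2)) * ((M : ℝ) / ((q ^ 2 : ℕ) : ℝ) + 1)) +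
       τm ^ 4 * ∑ q ∈ P₂, (M : ℝ) * (#(rootsCube (q ^ 2)) * ((M : ℝ) / ((q ^ 2 : ℕ) : ℝ) + 1))) ≤
      K * Lε * ((M : ℝ) ^ 2 / (D : ℝ) ^ ((1 : ℝ) / 4) + M * SQ + (M : ℝ) ^ 2 / Q₁ + M * #P₁ + (M : ℝ) ^ 2 / Q₂ + M * #P₂) := by
    have hX1 : 0 ≤ (M : ℝ) ^ 2 / (D : ℝ) ^ ((1 : ℝ) / 4) := by positivity
    have hX2 : 0 ≤ (M : ℝ) * SQ := by positivity
    have hX3 : 0 ≤ (M : ℝ) ^ 2 / Q₁ + M * #P₁ := by positivity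
    have hX4 : 0 ≤ (M : ℝ) ^ 2 / Q₂ + M * #P₂ := by positivity
    have hc1 : 0 ≤ Cd ^ 5 * (3 : ℝ) ^ (5 * ε₀) * Lε := by positivity
    have hc2 : 0 ≤ Cd ^ 4 * Cr * (3 : ℝ) ^ (5 * ε₀) * Lε := by positivity
    rw [hK]
    nlinarith [e1, e2, e3₁, e3₂, mul_nonneg hc1 hX2, mul_nonneg hc1 hX3, mul_nonneg hc1 hX4,
      mul_nonneg hc2 hX1, mul_nonneg hc2 hX2, mul_nonneg hc2 hX3, mul_nonneg hc2 hX4, mul_nonneg hc1 hX1]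
  linarith [h0, hα, hβ, hγ, hfinal]


end Literature.NumberTheory.Sieve.HeathBrown2001
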